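import Summits.AtomisticToContinuum.Crystallization.Theses.FreeSplittingCertificates
import Summits.AtomisticToContinuum.Crystallization.Theorems.FreeSplittingCertificatesDefectVanishOfStrict
import Summits.AtomisticToContinuum.Crystallization.Theorems.FreeSplittingCertificatesDefectVanishCrystallizes
import Summits.AtomisticToContinuum.Crystallization.Theorems.FreeSplittingCertificatesDefectVanishEnergy
import Summits.AtomisticToContinuum.Crystallization.Theorems.FreeSplittingCertificatesPeriodicUpperBound

/-!
# Route `FreeSplittingCertificates`, assembly item `Assembly`
# (stmt-AtomisticToContinuum-12571)

`StrictSplittingRule → ShellRigidityHcp → Crystallization`: the thesis "X₁ ∧ X₂ suffice" of route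
`AtomisticToContinuum/Crystallization/FreeSplittingCertificates`.

PROOF (pure logic on top of landed files). The route's deciding theorem
`Theses.FreeSplittingCertificates.closes` concludes `_root_.Crystallization` from the two cruxes
`StrictSplittingRule` (X₁), `ShellRigidityHcp` (X₂) and the four glue supports, all four of which
are proved in the tree:

* `DefectVanishOfStrict` — `defectVanishOfStrict_proof`
  (`FreeSplittingCertificatesDefectVanishOfStrict.lean`): X₁ at the ground-state hard core `δ₀`,
  X₂ at the selected `(a, t)`, slack counting via complementarity and `E(N) − N·e_∞ = o(N)`;
* `DefectVanishCrystallizes` — `defectVanishCrystallizes_proof`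
  (`FreeSplittingCertificatesDefectVanishCrystallizes.lean`): good sites, compactness of `O(3)` and
  the local-limit criterion give `IsCrystallizing lennardJones 3`;
* `DefectVanishEnergy` — `defectVanishEnergy_proof`
  (`FreeSplittingCertificatesDefectVanishEnergy.lean`): a charged periodic `P` attains the least
  periodic energy per particle and `E(N)/N → e(P)`;
* `PeriodicUpperBound` — `periodicUpperBound_proof`
  (`FreeSplittingCertificatesPeriodicUpperBound.lean`): `e_∞ ≤ e(Q)` for every periodic `Q`.

Hence `Assembly` holds unconditionally: given X₁ and X₂, feed them with the four proofs to `closes`.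
-/

namespace Summit.AtomisticToContinuum.Crystallization.Theorems

open Summit.AtomisticToContinuum.Crystallization.Theses.FreeSplittingCertificates

/-- **Item stmt-AtomisticToContinuum-12571** (`Assembly`, route `FreeSplittingCertificates`):
`StrictSplittingRule → ShellRigidityHcp → Crystallization`. The route's deciding theorem `closes`
applied to the two crux hypotheses and the four landed glue supports
`defectVanishOfStrict_proof`, `defectVanishCrystallizes_proof`, `defectVanishEnergy_proof`,
`periodicUpperBound_proof`. [folklore] -/
theorem freeSplittingCertificates_assembly_proof :
    Summit.AtomisticToContinuum.Crystallization.Theses.FreeSplittingCertificates.Assembly := by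
  unfold Summit.AtomisticToContinuum.Crystallization.Theses.FreeSplittingCertificates.Assembly
  intro h₁ h₂
  exact Summit.AtomisticToContinuum.Crystallization.Theses.FreeSplittingCertificates.closes h₁ h₂
    Summit.AtomisticToContinuum.Crystallization.Theorems.defectVanishOfStrict_proof
    FreeSplittingCertificatesDefectVanishCrystallizes.defectVanishCrystallizes_proof
    Summit.AtomisticToContinuum.Crystallization.Theorems.defectVanishEnergy_proof
    Summit.AtomisticToContinuum.Crystallization.Theorems.periodicUpperBound_proof

end Summit.AtomisticToContinuum.Crystallization.Theorems
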